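import Literature.Barriers.CriticalPhenomena.PlaquetteWalkHoleRootRowClasses
import Literature.Barriers.CriticalPhenomena.PlaquetteWalkHoleRootExtensionCounts
import HarnessLib

/-!
# Barrier catalogue (SAWScalingLimit): the level-`5` class-`B2b` members on the root row are ROW-COHERENT («EXTENSION CLASSES»)

`Z → ∞` limit model of the printed Yang–Baxter weights [GlazmanManolescu2019, §1, eq. (1)]; the «RECTANGLE COEFFICIENT» line. The second
kind of wound group member at limit cost `5` is the two-arc extension `ext₃ ω` of a wound class-`B2a` walk `ω` whose first arc in `r`
turns (`PlaquetteWalkHoleRootExtensionCost.cost_ext₃_eq_five_iff`: `ω` has cost `5` and ends on `N`/`S`, or cost `7` and ends on `E`/`W`).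
With a straight prefix and no doubly visited plaquette the parent's turn classes are known (`PlaquetteWalkHoleRootRowClasses`,
`PlaquetteWalkHoleRootChirality.chirality_of_cost_seven_east`), and `PlaquetteWalkHoleRootExtensionCounts` adds the one new arc:

* ★★ `ΩG.classes_of_cost_seven_east`: a cost-`7` wound class-`B2a` walk returning to `E` (straight prefix, injective) has
  `(n_{HL}, n_{VL}, n_{HR}, n_{VR}) = (3, 3, 0, 0)` (exit `N`) or `(0, 0, 3, 3)` (exit `S`), `n_{w₁} = n_{w₂} = 0` — census kit j280313;
* ★★★ `ΩG.rowCoherent_ext₃_of_cost_five`: if `ext₃ ω` has limit cost `5` then it is ROW-COHERENT: the four cases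
  (`W,N,S`)+`S→E` ↦ slot `E`, phase index `1`; (`W,S,N`)+`N→E` ↦ slot `E`, `5`; (`W,N,E`)+`E→S` ↦ slot `S`, `4`; (`W,S,E`)+`E→N` ↦ slot `N`, `2`.

With `PlaquetteWalkHoleRootRowClasses.rowCoherent_of_cost_five` this discharges BOTH per-member hypotheses of the ROW-COHERENCE CRITERION
`vertexFunctional_printed_zero_set_finite_of_rowCoherent` for the wound groups whose class-`B2a` walk has a straight prefix and an injective
plaquette map (venture lane «pcv-sawmu», b-engine-1 g25; DESIGN-next-g24 §2bis (R5)). [GlazmanManolescu2019 §1 Fig. 1, eq. (1), Lemma 2.1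
(proof: the groups of three walks); Glazman 2015 Lemma 3.1 (proof, pp. 6–7)]
-/

noncomputable section

namespace Literature.Probability.RandomPlanarGeometry.SAW.YangBaxter

open Real
open Literature.Barriers.CriticalPhenomena.PlaquetteWalk

open private IsNS ext₃_fst fc_fh from Literature.Probability.RandomPlanarGeometry.YangBaxterSAWGeneralDomain

namespace ΩG

variable {D : Set Face} {w r : Face} {ω : ΩG D (w.side .W) r}

/-- The fourth side through `z1`. [cite: GlazmanManolescu2019, Lemma 2.1 (proof: the groups of three walks); lane plumbing] -/
theorem z₃_eq_fourth (hr : RootedFace D (w.side .W) r) (h : ω.IsB2a) :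
    ω.z₃ hr h = Side.fourth ω.2.firstSideG (ω.z1 hr h) ω.1 := rfl

/-- ★★ **THE CLASSES OF THE COST-`7` PARENTS.** A wound class-`B2a` walk of limit cost `7` from the hole root returning to the `E` side of
`r`, with straight prefix and injective plaquette map, has `n_{w₁} = n_{w₂} = 0` and `(n_{HL}, n_{VL}, n_{HR}, n_{VR}) = (3, 3, 0, 0)` (exit
`N`, all left) or `(0, 0, 3, 3)` (exit `S`, all right). [cite: GlazmanManolescu2019, §1, Fig. 1 and eq. (1); §2.1; Lemma 2.1]
[cite: Glazman2015WeightedSAW, Lemma 3.1 (proof, pp. 6–7)] -/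
theorem classes_of_cost_seven_east (hh : holeFaceW w ∉ D) (hr : RootedFace D (w.side .W) r) (h : ω.IsB2a)
    (hA : ω.AJ hr h (toC (midPt (w.side .W))) ≠ 0) (hE : ω.1 = .E) (hc : cost (slotOfSide ω.1) ω.2.mids = 7)
    (hinj : ∀ i j, i < ω.2.arcs.length → j < ω.2.arcs.length → ω.2.fc i = ω.2.fc j → i = j)
    (hstr : ∀ i < ω.2.firstHitG, arcKind (ω.2.sIn i) (ω.2.sOut i) = .straight) :
    cfgCount ω.2.mids [.corner, .corner] = 0 ∧ cfgCount ω.2.mids [.coCorner, .coCorner] = 0 ∧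
      ((ω.z1 hr h = .N ∧ hlCount ω.2.mids = 3 ∧ vlCount ω.2.mids = 3 ∧ hrCount ω.2.mids = 0 ∧ vrCount ω.2.mids = 0) ∨
        (ω.z1 hr h = .S ∧ hlCount ω.2.mids = 0 ∧ vlCount ω.2.mids = 0 ∧ hrCount ω.2.mids = 3 ∧ vrCount ω.2.mids = 3)) := by
  obtain ⟨hp1, hp2⟩ := ω.2.pairs_eq_zero_of_injective hinj
  refine ⟨hp1, hp2, ?_⟩
  have hq := quarterTurnsL_eq_classes ω.2.mids
  have htel := hvCount_sub_vhCount_walk ω.2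
  obtain ⟨hhv, hvh⟩ := hvCount_eq ω.2
  have hz : vertB (r.side ω.1) = true := by rw [hE]; exact (vertB_side r).2.1
  rw [hhv, hvh, (vertB_side w).1, hz] at htel
  have hchi := chirality_of_cost_seven_east hh hr h hA hE hc hinj hstr
  have hqt := quarterTurns_of_cost_seven_east hh hr h hA hE hstr
  rcases hchi with ⟨hN, hall⟩ | ⟨hS, hall⟩
  · left
    obtain ⟨h1, h2⟩ := hrCount_vrCount_eq_zero_of_left ω.2.mids hall
    rcases hqt with ⟨-, h6⟩ | ⟨hS, -⟩
    · rw [h1, h2] at hq htel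
      refine ⟨hN, ?_, ?_, h1, h2⟩ <;> push_cast at hq htel <;> simp at htel <;> omega
    · rw [hN] at hS; exact absurd hS (by decide)
  · right
    obtain ⟨h1, h2⟩ := hlCount_vlCount_eq_zero_of_right ω.2.mids hall
    rcases hqt with ⟨hN, -⟩ | ⟨-, h6⟩
    · rw [hS] at hN; exact absurd hN (by decide)
    · rw [h1, h2] at hq htel
      refine ⟨hS, h1, h2, ?_, ?_⟩ <;> push_cast at hq htel <;> simp at htel <;> omega

/-- The phase data of the extension from the parent's: `n_{VL}`, `n_{[k,k]}` (`k` the kind of the first arc in `r`, `+1`) and the other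
pair count (unchanged). [cite: GlazmanManolescu2019, Lemma 2.1 (proof: the groups of three walks); §1, Fig. 1 and eq. (1)] -/
theorem ext₃_phase_data (hr : RootedFace D (w.side .W) r) (hN : IsNS ω hr) :
    (ω.ext₃ hr).1 = ω.z₃ hr hN.1 ∧
    vlCount (ω.ext₃ hr).2.mids = vlCount ω.2.mids + (if isVL (ω.1, ω.z₃ hr hN.1) then 1 else 0) ∧
    (arcKind ω.2.firstSideG (ω.z1 hr hN.1) = .corner →
      cfgCount (ω.ext₃ hr).2.mids [.corner, .corner] = cfgCount ω.2.mids [.corner, .corner] + 1 ∧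
        cfgCount (ω.ext₃ hr).2.mids [.coCorner, .coCorner] = cfgCount ω.2.mids [.coCorner, .coCorner]) ∧
    (arcKind ω.2.firstSideG (ω.z1 hr hN.1) = .coCorner →
      cfgCount (ω.ext₃ hr).2.mids [.coCorner, .coCorner] = cfgCount ω.2.mids [.coCorner, .coCorner] + 1 ∧
        cfgCount (ω.ext₃ hr).2.mids [.corner, .corner] = cfgCount ω.2.mids [.corner, .corner]) := by
  have h := hN.1
  obtain ⟨-, hf2, hf3⟩ := fc_fh ω hr h
  have hk : arcKind (ω.2.sIn ω.2.firstHitG) (ω.2.sOut ω.2.firstHitG) = arcKind ω.2.firstSideG (ω.z1 hr h) := by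
    rw [hf2, hf3]; rfl
  have hNS : arcKind (ω.2.sIn ω.2.firstHitG) (ω.2.sOut ω.2.firstHitG) ≠ .straight := by rw [hk]; exact hN.2
  refine ⟨ext₃_fst ω hr hN, vlCount_ext₃ hr hN, fun hc => ?_, fun hc => ?_⟩
  · have e1 := cfgCount_ext₃_pair hr h hNS
    have e2 := cfgCount_ext₃_of_ne hr h hNS (κ := [.coCorner, .coCorner]) (by rw [hk, hc]; decide) (by rw [hk, hc]; decide)
    rw [hk, hc] at e1
    exact ⟨e1.symm, e2⟩
  · have e1 := cfgCount_ext₃_pair hr h hNS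
    have e2 := cfgCount_ext₃_of_ne hr h hNS (κ := [.corner, .corner]) (by rw [hk, hc]; decide) (by rw [hk, hc]; decide)
    rw [hk, hc] at e1
    exact ⟨e1.symm, e2⟩

/-- ★★★ **THE LEVEL-`5` CLASS-`B2b` MEMBERS ARE ROW-COHERENT.** Let `ω` be a wound class-`B2a` walk from the hole root `w.side W` whose first
arc in `r` turns (an `NS` group), with straight prefix and injective plaquette map, and suppose its two-arc extension `ext₃ ω` has limit
cost `5`. Then `ext₃ ω` is ROW-COHERENT: by `cost_ext₃_eq_five_iff` the parent is a cost-`5` walk ending on `N`/`S` (classes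
`(3,2,0,0)` / `(0,0,3,2)`, `PlaquetteWalkHoleRootRowClasses`) or a cost-`7` walk ending on `E` (classes `(3,3,0,0)` / `(0,0,3,3)`), and the new
arc inside `r` gives phase index `1`, `5` on the slot `E` and `4`, `2` on the slots `S`, `N`.
[cite: GlazmanManolescu2019, §1, Fig. 1 and eq. (1); Lemma 2.1 (proof: the groups of three walks), eq. (CR)] [cite: Glazman2015WeightedSAW, Lemma 3.1 (proof, pp. 6–7)] -/
theorem rowCoherent_ext₃_of_cost_five (hh : holeFaceW w ∉ D) (hr : RootedFace D (w.side .W) r) (hN : IsNS ω hr)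
    (hA : ω.AJ hr hN.1 (toC (midPt (w.side .W))) ≠ 0)
    (hc : cost (slotOfSide (ω.ext₃ hr).1) (ω.ext₃ hr).2.mids = 5)
    (hinj : ∀ i j, i < ω.2.arcs.length → j < ω.2.arcs.length → ω.2.fc i = ω.2.fc j → i = j)
    (hstr : ∀ i < ω.2.firstHitG, arcKind (ω.2.sIn i) (ω.2.sOut i) = .straight) :
    RowCoherent (slotOfSide (ω.ext₃ hr).1) (ω.ext₃ hr).2.mids := by
  have h := hN.1
  obtain ⟨-, hf2, hf3⟩ := fc_fh ω hr h
  have hNS : arcKind (ω.2.sIn ω.2.firstHitG) (ω.2.sOut ω.2.firstHitG) ≠ .straight := by rw [hf2, hf3]; exact hN.2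
  obtain ⟨-, hW⟩ := root_row_of_straight_prefix hh hr h hstr
  obtain ⟨h01, h02, h12⟩ := ω.firstSide_exit_return_distinct hr h
  rw [hW] at h01 h02
  have hturn : arcKind Side.W (ω.z1 hr h) ≠ .straight := by have := hN.2; rwa [hW] at this
  obtain ⟨hfst, hvl, hcase1, hcase2⟩ := ext₃_phase_data hr hN
  rw [hW] at hcase1 hcase2
  have hz3 := z₃_eq_fourth hr h
  rw [hW] at hz3
  rcases (cost_ext₃_eq_five_iff hr h hNS).1 hc with ⟨hc5, hNS'⟩ | ⟨hc7, hEW⟩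
  · -- parent of cost `5`, ending on `N` or `S`
    obtain ⟨hp1, hp2, hcls⟩ := classes_of_cost_five hh hr h hA hc5 hinj hstr
    rcases hcls with ⟨hS, -, hvl2, -, -⟩ | ⟨hNn, -, hvl0, -, -⟩
    · -- `(W, N, S)` + the new arc `S → E`: slot `E`, phase index `1`
      have hz1 : ω.z1 hr h = .N := by
        have h12' : ω.z1 hr h ≠ Side.S := fun e => h12 (e.trans hS.symm)
        revert h01 h12' hturn; cases ω.z1 hr h <;> decide
      have hz3' : ω.z₃ hr h = .E := by rw [hz3, hz1, hS]; decide
      obtain ⟨hcc, hco⟩ := hcase1 (by rw [hz1]; rfl)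
      have hvl' : vlCount (ω.ext₃ hr).2.mids = 2 := by rw [hvl, hvl2, hz3', hS]; rfl
      have hX : phaseIndex (ω.ext₃ hr).2.mids = 1 := by unfold phaseIndex; rw [hvl', hcc, hco, hp1, hp2]
      have hs : slotOfSide (ω.ext₃ hr).1 = 0 := by rw [hfst, hz3']; rfl
      rw [hs]; unfold RowCoherent
      exact ⟨fun e => absurd e (by decide), fun e => absurd e (by decide), fun _ => Or.inl hX⟩
    · -- `(W, S, N)` + the new arc `N → E`: slot `E`, phase index `5`
      have hz1 : ω.z1 hr h = .S := by
        have h12' : ω.z1 hr h ≠ Side.N := fun e => h12 (e.trans hNn.symm)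
        revert h01 h12' hturn; cases ω.z1 hr h <;> decide
      have hz3' : ω.z₃ hr h = .E := by rw [hz3, hz1, hNn]; decide
      obtain ⟨hcc, hco⟩ := hcase2 (by rw [hz1]; rfl)
      have hvl' : vlCount (ω.ext₃ hr).2.mids = 1 := by rw [hvl, hvl0, hz3', hNn]; rfl
      have hX : phaseIndex (ω.ext₃ hr).2.mids = 5 := by unfold phaseIndex; rw [hvl', hcc, hco, hp1, hp2]
      have hs : slotOfSide (ω.ext₃ hr).1 = 0 := by rw [hfst, hz3']; rfl
      rw [hs]; unfold RowCoherent
      exact ⟨fun e => absurd e (by decide), fun e => absurd e (by decide), fun _ => Or.inr hX⟩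
  · -- parent of cost `7`, ending on `E` (`W` is the first side)
    have hE : ω.1 = .E := by
      rcases hEW with e | e
      · exact e
      · exact absurd e.symm h02
    obtain ⟨hp1, hp2, hcls⟩ := classes_of_cost_seven_east hh hr h hA hE hc7 hinj hstr
    rcases hcls with ⟨hz1, -, hvl3, -, -⟩ | ⟨hz1, -, hvl0, -, -⟩
    · -- `(W, N, E)` + the new arc `E → S`: slot `S`, phase index `4`
      have hz3' : ω.z₃ hr h = .S := by rw [hz3, hz1, hE]; decide
      obtain ⟨hcc, hco⟩ := hcase1 (by rw [hz1]; rfl)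
      have hvl' : vlCount (ω.ext₃ hr).2.mids = 3 := by rw [hvl, hvl3, hz3', hE]; rfl
      have hX : phaseIndex (ω.ext₃ hr).2.mids = 4 := by unfold phaseIndex; rw [hvl', hcc, hco, hp1, hp2]
      have hs : slotOfSide (ω.ext₃ hr).1 = 3 := by rw [hfst, hz3']; rfl
      rw [hs]; unfold RowCoherent
      exact ⟨fun e => absurd e (by decide), fun _ => Or.inl hX, fun e => absurd e (by decide)⟩
    · -- `(W, S, E)` + the new arc `E → N`: slot `N`, phase index `2`
      have hz3' : ω.z₃ hr h = .N := by rw [hz3, hz1, hE]; decide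
      obtain ⟨hcc, hco⟩ := hcase2 (by rw [hz1]; rfl)
      have hvl' : vlCount (ω.ext₃ hr).2.mids = 0 := by rw [hvl, hvl0, hz3', hE]; rfl
      have hX : phaseIndex (ω.ext₃ hr).2.mids = 2 := by unfold phaseIndex; rw [hvl', hcc, hco, hp1, hp2]
      have hs : slotOfSide (ω.ext₃ hr).1 = 1 := by rw [hfst, hz3']; rfl
      rw [hs]; unfold RowCoherent
      exact ⟨fun _ => Or.inr hX, fun e => absurd e (by decide), fun e => absurd e (by decide)⟩

end ΩG

end Literature.Probability.RandomPlanarGeometry.SAW.YangBaxter
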